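import Literature.Computability.Cryptography.IndistinguishabilityRepeated
import Literature.Computability.Cryptography.PRGStretchExtension
import HarnessLib

/-!
# Many independent outputs of a pseudorandom generator are pseudorandom (Goldreich 2001, §3.3 with Thm. 3.2.6)

A standard consequence of Thm. 3.2.6 (indistinguishability of repeated samples,
`IndistinguishabilityRepeated.lean`): the output ensemble `G(U_n)` of a pseudorandom generator is
polynomial-time constructible and indistinguishable from `U_{ℓ(n)}` (also constructible), so for every
polynomial `t` the concatenation of `t(n)` outputs of `G` on independent seeds is indistinguishable
from `U_{t(n)·ℓ(n)}` — i.e. pseudorandom. Goldreich 2001, §3.3.1 (PDF p. 145): pseudorandom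
generators "can be used … any polynomial number of times" / Def. 3.2.4–3.2.5 with Thm. 3.2.6
(p. 139): "for every polynomial `m`, the `m(n)`-products are indistinguishable". Contents:

* `PRGRep.seedSampler G = G ∘ takeFn` (on `⟨1ⁿ, s⟩`: `G(s ↾ n)`) and `PRGRep.unifSampler G`
  (`⟨1ⁿ, s⟩ ↦ s ↾ |G(0ⁿ)| = s ↾ ℓ(n)`), two `FP` samplers on `P(n) ≥ max(n, ℓ(n))` coins presenting
  `G(U_n)` and `U_{ℓ(n)}` as `seedEnsemble`s (`seedEnsemble_seedSampler`, `seedEnsemble_unifSampler`);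
* `map_blocks_uniformBits` — reading `g` off the `q`-prefixes of the `M` blocks (length `P ≥ q`) of
  `U_{M·P}` has the law of reading `g` off the `M` blocks of `U_{M·q}` (from the tree's
  `uniformBits_add`, `uniformBits_map_take`); hence `prodEnsemble_seedSampler`,
  `prodEnsemble_unifSampler` (the products are `t(n)` independent outputs, resp. `U_{t(n)ℓ(n)}`);
* **`IsPRG.isPseudorandom_repeated`** — for a pseudorandom generator `G` of stretch `ℓ` and a
  polynomial `t`, `n ↦ G(s₁) ⋯ G(s_{t(n)})` (`sᵢ ← U_n` independent) is pseudorandom against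
  `U_{t(n)·ℓ(n)}`.

## References

* O. Goldreich, *Foundations of Cryptography I: Basic Tools*, CUP 2001 (2004 printing): Def. 3.2.4,
  Def. 3.2.5, Thm. 3.2.6 (PDF p. 139), Def. 3.3.1 and §3.3.1 (PDF pp. 144–145).
-/

namespace Literature.Computability.Cryptography

open Filter Polynomial _root_.Computability Complexity Complexity.Brick Complexity.Plumb Hybrid RepSamp PRGStretch PRGTrunc

namespace PRGRep

/-! ### The two samplers -/

/-- `seedSampler G ⟨u, s⟩ = G (s ↾ |u|)`: the generator run on the first `n` of the coins. [folklore] -/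
noncomputable def seedSampler (G : List Bool → List Bool) : List Bool → List Bool := G ∘ takeFn

/-- `unifSampler G ⟨u, s⟩ = s ↾ |G(0^{|u|})|` (`= s ↾ ℓ(n)` for `u = 1ⁿ`): a uniform string of the
generator's output length, read off the coins. [folklore] -/
noncomputable def unifSampler (G : List Bool → List Bool) : List Bool → List Bool :=
  takeFn ∘ fanoutFn (G ∘ Kannan.zerosFn ∘ fstF) sndF

/-- Value of `seedSampler`. [folklore] -/
@[simp] theorem seedSampler_boolPair (G : List Bool → List Bool) (u s : List Bool) :
    seedSampler G (boolPair u s) = G (s.take u.length) := by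
  simp [seedSampler]

/-- Value of `unifSampler`. [folklore] -/
@[simp] theorem unifSampler_boolPair (G : List Bool → List Bool) (u s : List Bool) :
    unifSampler G (boolPair u s) = s.take (G (List.replicate u.length false)).length := by
  simp [unifSampler]

/-- `seedSampler G ∈ FP` for `G ∈ FP`. [folklore] -/
theorem seedSampler_mem_FP {G : List Bool → List Bool} (hG : G ∈ FP) : seedSampler G ∈ FP :=
  comp_mem_FP hG takeFn_mem_FP

/-- `unifSampler G ∈ FP` for `G ∈ FP`. [folklore] -/
theorem unifSampler_mem_FP {G : List Bool → List Bool} (hG : G ∈ FP) : unifSampler G ∈ FP :=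
  comp_mem_FP takeFn_mem_FP (fanoutFn_mem_FP (comp_mem_FP hG (comp_mem_FP Kannan.zerosFn_mem_FP fstF_mem_FP)) sndF_mem_FP)

/-- `|1ⁿ| = n` (private restatement of Mathlib's `unary_decode_encode_nat`). [folklore] -/
private theorem length_unary (n : ℕ) : (unaryEncodeNat n).length = n := unary_decode_encode_nat n

/-- **`seedEnsemble (seedSampler G) P = (G(U_n))ₙ`** when `n ≤ P(n)`. [folklore] -/
theorem seedEnsemble_seedSampler (G : List Bool → List Bool) {P : Polynomial ℕ} (hP : ∀ n, n ≤ P.eval n) :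
    seedEnsemble (seedSampler G) P = fun n => (uniformBits n).map G := by
  funext n
  unfold seedEnsemble
  have h : (fun s => seedSampler G (boolPair (unaryEncodeNat n) s)) = G ∘ fun s => s.take n := by
    funext s; simp
  rw [h, ← PMF.map_comp, PRGPrefix.uniformBits_map_take (hP n)]

/-- **`seedEnsemble (unifSampler G) P = (U_{ℓ(n)})ₙ`** when `|G s| = ℓ |s|` and `ℓ(n) ≤ P(n)`. [folklore] -/
theorem seedEnsemble_unifSampler {G : List Bool → List Bool} {ℓ : ℕ → ℕ} (hlen : ∀ s, (G s).length = ℓ s.length)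
    {P : Polynomial ℕ} (hP : ∀ n, ℓ n ≤ P.eval n) :
    seedEnsemble (unifSampler G) P = uniformEnsemble ℓ := by
  funext n
  unfold seedEnsemble uniformEnsemble
  have h : (fun s => unifSampler G (boolPair (unaryEncodeNat n) s)) = fun s => s.take (ℓ n) := by
    funext s; simp [hlen]
  rw [h, PRGPrefix.uniformBits_map_take (hP n)]

/-- Output length of `seedSampler`. [folklore] -/
theorem hasOutLen_seedSampler {G : List Bool → List Bool} {ℓ : ℕ → ℕ} (hlen : ∀ s, (G s).length = ℓ s.length)
    {P : Polynomial ℕ} (hP : ∀ n, n ≤ P.eval n) : HasOutLen (seedSampler G) P ℓ := by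
  intro n s hs
  rw [seedSampler_boolPair, hlen, List.length_take, length_unary, hs, min_eq_left (hP n)]

/-- Output length of `unifSampler`. [folklore] -/
theorem hasOutLen_unifSampler {G : List Bool → List Bool} {ℓ : ℕ → ℕ} (hlen : ∀ s, (G s).length = ℓ s.length)
    {P : Polynomial ℕ} (hP : ∀ n, ℓ n ≤ P.eval n) : HasOutLen (unifSampler G) P ℓ := by
  intro n s hs
  rw [unifSampler_boolPair, List.length_take, hlen, List.length_replicate, length_unary, hs, min_eq_left (hP n)]

/-! ### Blocks of a uniform string -/

/-- Block `0` of a concatenation with a first part of block length. [folklore] -/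
theorem blk_zero_append {P : ℕ} {x : List Bool} (hx : x.length = P) (y : List Bool) : blk P 0 (x ++ y) = x := by
  simp [blk, List.take_append_of_le_length hx.ge, List.take_of_length_le hx.le]

/-- Later blocks of a concatenation with a first part of block length. [folklore] -/
theorem blk_succ_append {P : ℕ} {x : List Bool} (hx : x.length = P) (y : List Bool) (i : ℕ) :
    blk P (i + 1) (x ++ y) = blk P i y := by
  simp only [blk]
  rw [List.drop_append, hx, List.drop_of_length_le (by rw [hx, Nat.succ_mul]; omega), List.nil_append]
  congr 2
  rw [Nat.succ_mul]
  omega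

/-- Strings in the support of `U_m` have length `m`. [folklore] -/
private theorem length_of_mem_support_uniformBits {m : ℕ} {s : List Bool} (hs : s ∈ (uniformBits m).support) :
    s.length = m := by
  rw [uniformBits, PMF.mem_support_map_iff] at hs
  obtain ⟨v, -, rfl⟩ := hs
  exact v.toList_length

/-- **Reading a map off the `q`-prefixes of the blocks of a uniform string**: for `q ≤ P`, the law of
`(g ((blk P i R) ↾ q))_{i<M}` (concatenated) for `R ← U_{M·P}` is the law of `(g (blk q i R'))_{i<M}` for
`R' ← U_{M·q}` — independent uniform blocks stay independent uniform after truncation.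
[Goldreich 2001, §1.3 (`U_n`), Def. 3.2.4 (independent copies)] [folklore] -/
theorem map_blocks_uniformBits (g : List Bool → List Bool) {q P : ℕ} (hq : q ≤ P) : ∀ M : ℕ,
    (uniformBits (M * P)).map (fun R => ((List.range M).map fun i => g ((blk P i R).take q)).flatten) =
      (uniformBits (M * q)).map fun R => ((List.range M).map fun i => g (blk q i R)).flatten
  | 0 => by simp
  | M + 1 => by
    have ih := map_blocks_uniformBits g hq M
    rw [show (M + 1) * P = P + M * P by ring, show (M + 1) * q = q + M * q by ring, ← uniformBits_add P (M * P),
      PMF.map_bind, ← uniformBits_add q (M * q), ← PRGPrefix.uniformBits_map_take hq, PMF.bind_map, PMF.map_bind]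
    refine pmf_bind_congr_of_mem_support _ fun x hx => ?_
    have hxl : x.length = P := length_of_mem_support_uniformBits hx
    have hxq : (x.take q).length = q := by rw [List.length_take, hxl, min_eq_left hq]
    rw [PMF.map_comp, Function.comp_apply, PMF.map_comp]
    -- peel block `0`
    have h1 : ((fun R => ((List.range (M + 1)).map fun i => g ((blk P i R).take q)).flatten) ∘ fun y => x ++ y) =
        (fun w => g (x.take q) ++ w) ∘ fun y => ((List.range M).map fun i => g ((blk P i y).take q)).flatten := by
      funext y
      simp only [Function.comp_apply, List.range_succ_eq_map, List.map_cons, List.map_map, List.flatten_cons]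
      rw [blk_zero_append hxl]
      congr 1
      refine congrArg List.flatten (List.map_congr_left fun i _ => ?_)
      rw [Function.comp_apply, blk_succ_append hxl]
    have h2 : ((fun R => ((List.range (M + 1)).map fun i => g (blk q i R)).flatten) ∘ fun y => x.take q ++ y) =
        (fun w => g (x.take q) ++ w) ∘ fun y => ((List.range M).map fun i => g (blk q i y)).flatten := by
      funext y
      simp only [Function.comp_apply, List.range_succ_eq_map, List.map_cons, List.map_map, List.flatten_cons]
      rw [blk_zero_append hxq]
      congr 1
      refine congrArg List.flatten (List.map_congr_left fun i _ => ?_)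
      rw [Function.comp_apply, blk_succ_append hxq]
    rw [h1, h2, ← PMF.map_comp, ← PMF.map_comp, ih]

/-- The blocks of a string of length `M·q` concatenate back to the string. [folklore] -/
theorem flatten_blocks_self {q : ℕ} : ∀ (M : ℕ) (R : List Bool), R.length = M * q →
    ((List.range M).map fun i => blk q i R).flatten = R
  | 0, R, hR => by simp [List.eq_nil_of_length_eq_zero (by simpa using hR)]
  | M + 1, R, hR => by
    have hx : (R.take q).length = q := by rw [List.length_take, hR, Nat.succ_mul]; exact min_eq_left (by omega)
    have hy : (R.drop q).length = M * q := by rw [List.length_drop, hR, Nat.succ_mul]; omega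
    rw [List.range_succ_eq_map, List.map_cons, List.map_map, List.flatten_cons]
    have hmap : (List.range M).map ((fun i => blk q i R) ∘ Nat.succ) = (List.range M).map fun i => blk q i (R.drop q) :=
      List.map_congr_left fun i _ => by
        rw [Function.comp_apply]
        conv_lhs => rw [← List.take_append_drop q R]
        exact blk_succ_append hx (R.drop q) i
    rw [hmap, flatten_blocks_self M (R.drop q) hy]
    simp [blk]

/-- **The product of `unifSampler` is uniform**: `prodEnsemble (unifSampler G) P t n = U_{t(n)·ℓ(n)}`.
[folklore] -/
theorem prodEnsemble_unifSampler {G : List Bool → List Bool} {ℓ : ℕ → ℕ} (hlen : ∀ s, (G s).length = ℓ s.length)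
    {P : Polynomial ℕ} (hP : ∀ n, ℓ n ≤ P.eval n) (t : Polynomial ℕ) (n : ℕ) :
    prodEnsemble (unifSampler G) P t n = uniformBits (t.eval n * ℓ n) := by
  unfold prodEnsemble
  have h : (fun R => ((List.range (t.eval n)).map fun i => unifSampler G (boolPair (unaryEncodeNat n) (blk (P.eval n) i R))).flatten) =
      fun R => ((List.range (t.eval n)).map fun i => id ((blk (P.eval n) i R).take (ℓ n))).flatten := by
    funext R; simp [hlen]
  rw [h, map_blocks_uniformBits id (hP n)]
  conv_rhs => rw [← PMF.map_id (uniformBits (t.eval n * ℓ n))]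
  rw [uniformBits, PMF.map_comp, PMF.map_comp]
  congr 1
  funext v
  simp only [Function.comp_apply, id]
  exact flatten_blocks_self _ _ v.toList_length

/-- **The product of `seedSampler` is `t(n)` independent outputs of `G`**:
`prodEnsemble (seedSampler G) P t n = (G(s₁) ⋯ G(s_{t(n)}))`, `sᵢ ← U_n` the `n`-bit blocks of
`U_{t(n)·n}`. [folklore] -/
theorem prodEnsemble_seedSampler (G : List Bool → List Bool) {P : Polynomial ℕ} (hP : ∀ n, n ≤ P.eval n)
    (t : Polynomial ℕ) (n : ℕ) :
    prodEnsemble (seedSampler G) P t n =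
      (uniformBits (t.eval n * n)).map fun R => ((List.range (t.eval n)).map fun i => G (blk n i R)).flatten := by
  unfold prodEnsemble
  have h : (fun R => ((List.range (t.eval n)).map fun i => seedSampler G (boolPair (unaryEncodeNat n) (blk (P.eval n) i R))).flatten) =
      fun R => ((List.range (t.eval n)).map fun i => G ((blk (P.eval n) i R).take n)).flatten := by
    funext R; simp
  rw [h, map_blocks_uniformBits G (hP n)]

end PRGRep

open PRGRep

/-! ### The theorem -/

/-- **Many independent outputs of a pseudorandom generator are pseudorandom.** If `G` is a
pseudorandom generator of stretch `ℓ`, then for every polynomial `t` the ensemble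
`n ↦ G(s₁) ⋯ G(s_{t(n)})` (`s₁, …, s_{t(n)} ← U_n` independent, read off `U_{t(n)·n}`) is
pseudorandom, i.e. computationally indistinguishable from `n ↦ U_{t(n)·ℓ(n)}` — Thm. 3.2.6 applied to
the constructible ensembles `G(U_n)` and `U_{ℓ(n)}`. [Goldreich 2001, Thm. 3.2.6 with Def. 3.3.1
(§3.3.1, PDF pp. 139, 144–145)] [cite: Goldreich2001, Thm. 3.2.6 with Def. 3.3.1] -/
theorem IsPRG.isPseudorandom_repeated {G : List Bool → List Bool} {ℓ : ℕ → ℕ} (hG : IsPRG G ℓ)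
    (t : Polynomial ℕ) :
    IsPseudorandom (fun n => (uniformBits (t.eval n * n)).map fun R =>
        ((List.range (t.eval n)).map fun i => G (blk n i R)).flatten)
      (fun n => t.eval n * ℓ n) := by
  obtain ⟨p, hp⟩ := exists_poly_stretch_le hG.polyTimeComputable hG.length_eq
  set P : Polynomial ℕ := p + X with hPdef
  have hPn : ∀ n, n ≤ P.eval n := fun n => by simp [hPdef]
  have hPℓ : ∀ n, ℓ n ≤ P.eval n := fun n => by have := hp n; simp [hPdef]; omega
  have h0 : IsCompIndistinguishable (seedEnsemble (seedSampler G) P) (seedEnsemble (unifSampler G) P) := by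
    rw [seedEnsemble_seedSampler G hPn, seedEnsemble_unifSampler hG.length_eq hPℓ]
    exact hG.isPseudorandom
  have h1 := isCompIndistinguishable_prodEnsemble (seedSampler_mem_FP hG.polyTimeComputable)
    (unifSampler_mem_FP hG.polyTimeComputable) (hasOutLen_seedSampler hG.length_eq hPn)
    (hasOutLen_unifSampler hG.length_eq hPℓ) h0 t
  have hX : Literature.Computability.Cryptography.prodEnsemble (seedSampler G) P t =
      fun n => (uniformBits (t.eval n * n)).map fun R => ((List.range (t.eval n)).map fun i => G (blk n i R)).flatten :=
    funext fun n => prodEnsemble_seedSampler G hPn t n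
  have hY : Literature.Computability.Cryptography.prodEnsemble (unifSampler G) P t = uniformEnsemble fun n => t.eval n * ℓ n :=
    funext fun n => prodEnsemble_unifSampler hG.length_eq hPℓ t n
  rw [hX, hY] at h1
  exact h1

end Literature.Computability.Cryptography
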